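import Summits.QuantumFields.YangMills.Theorems.BalabanLadderUVSeamRecColdWallSplitElementaryWindow
import Summits.QuantumFields.YangMills.Theorems.BalabanLadderUVSeamRecClassicalResponseDirichlet
import Summits.QuantumFields.YangMills.Theorems.BalabanLadderUVSeamRecClassicalResponseThermalFloor
import Summits.QuantumFields.YangMills.Theorems.BalabanLadderNTBoundaryLawCentred
import HarnessLib

/-!
# Crux `UVSeamRec` (stmt-QuantumFields-20043), line «coldwall_pure», stub `stub_classicalDominanceFemtoTail` (SD-tail ≡ CW♭-tail):
# the LOCALISED tilt inequality, domain monotonicity of the classical response, and the ceiling of separate-deficit methods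

Helper file (`--supports stmt-QuantumFields-20043`) of the successor LEAD seat `ymfull-r2d-prover-2` (gen 0); sequel of LEAD g16's
`…ColdWallSplitElementaryWindow` and g18's `…CarrierFlatWindow`.

THE SITUATION.  The β-free cold-wall split «`(R⁴/C₁)|kerE^η(plane q x) − kerE^𝟙(plane q x)| ≤ A₂ + carrierCl C_s 1 1 R q x η`» is a THEOREM for every
exterior on the window `R + 1 ≤ ⌈β^θ⌉`, `θ < 1/8` (`coldWallSplitFlat_window`), by the tilt inequality
`kerE^η(N − plane) ≤ cr₁(η) + [kerE^η(S_Λ) − m₀(η)]` (`kerE_deficit_le_classicalResponse_add_excess`) and the thermal excess of the WHOLE box,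
`#P_Λ·(38 + 12 log β)/β ≍ R⁴ log β/β`; against the resolution `C₁A₂/R⁴` this dies at `R⁸ log β ≍ β`.

THIS FILE.
* §1 (every compact `G`) **domain monotonicity of the classical response** (`classicalResponse_le_of_subset_add_excess`): for nested cubes `Λ' ⊆ Λ`,
  every exterior `η` and EVERY inner configuration `ζ` of `Λ`,
  `cr_s^{Λ'}(ζ ∨ η) ≤ cr_s^{Λ}(η) + [S_Λ(ζ ∨ η) − m₀^{Λ}(η)]/s`
  — the small-cube response of any configuration is at most the big-cube response of the exterior plus the configuration's excess energy
  (the case `Λ' = ` «the centre plaquette alone» is g16's tilt inequality); at a ground state the excess vanishes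
  (`classicalResponse_le_of_subset_of_mem_cubeMinimisers`).  Ingredient: the action splitting `S_Λ(V) − S_Λ'(V) = S_Λ(U) − S_Λ'(U)` for `V = U` off `Λ'`
  (`wilsonBoundaryAction_sub_eq_of_eqOff`, with the tree's `plaquettesTouching_mono`).
* §2 (every compact `G`) **the LOCALISED tilt inequality** (`kerE_deficit_le_kerE_classicalResponse_add_excess_of_subset`): DLR consistency
  `kerE^η_Λ = kerE^η_Λ ∘ kerE^{·}_{Λ'}` (tree `kerE_kerE_of_subset`) and the tilt inequality INSIDE the small cube give
  `kerE^η_Λ(N − plane q x) ≤ kerE^η_Λ( cr₁^{Λ'} + [kerE^{·}_{Λ'}(S_Λ') − m₀^{Λ'}] )`: the thermal excess is now that of the SMALL cube.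
* §3 (`SU(2)`) **numbers**: `kerE^η_R(2 − plane q x) ≤ kerE^η_R(cr₁^{(r₀)}) + 120(2r₀+3)⁴(38 + 12 log β)/β` for `r₀ ≤ R`
  (`kerE_deficit_le_kerE_localResponse_add`), hence
  `|kerE^η_R(plane) − kerE^𝟙_R(plane)| ≤ max(kerE^η_R cr₁^{(r₀)}, kerE^𝟙_R cr₁^{(r₀)}) + 120(2r₀+3)⁴(38 + 12 log β)/β`
  (`abs_kerE_plane_sub_le_localResponse_add`): the slop no longer grows with `R`; the price is the MEAN LOCAL classical response under the two
  Dirichlet states (`coldWallSplitFlat_inequality_of_localBudget`: the stub's sentence at a point reduces to a LOCAL RESPONSE BUDGET).  The sequel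
  `…ColdWallLocalisedTiltWindow` turns this into (CW♭) for every exterior on the window `R + 1 ≤ ⌈β^θ⌉`, every `θ < 1/4` (twice g16's exponent),
  GIVEN a local-response-mean bound `kerE^η_R(cr₁^{(r₀)}) ≤ K/β + K'·cr₁^{(R)}(η)` (NOT proved anywhere yet).
* §4 (`SU(2)`) **the ceiling of the method class** (`rhs_lt_tolerance_units_kerE_one_deficit`): by the landed thermal FLOOR `kerE^η(2 − plane) ≥ 6/(24β+3)`
  (`ThermalFloor.kerE_deficit_ge`, every exterior), already the identity exterior's own centre deficit in tolerance units, `(R⁴/C₁)·kerE^𝟙(2 − plane)`,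
  EXCEEDS the whole right-hand side of (CW♭) at `η = 𝟙` (which is `A₂`, `carrierCl_one`) as soon as `6R⁴ > C₁A₂(24β + 3)`.  Every argument that bounds
  `|kerE^η(plane) − kerE^𝟙(plane)|` by a quantity `≥` one of the two (non-negative) centre deficits — g15, g16, g18 and §§2–3 here — is therefore
  confined to `R⁴ ≲ 4C₁A₂β`: the window exponent `1/4` of the sequel is SHARP for the class, and the femto tail `β^{1/4} ≲ R ≤ ℓ₂/uRec β` of the stub needs the
  CANCELLATION of the two `O(1/β)` thermal deficits to accuracy `C₁A₂/R⁴` (two-sided uniform Laplace asymptotics with matching Gaussian determinants,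
  i.e. Bałaban's background-field expansion of the cube kernel) — located, not supplied.

HONEST FRAMING: elementary consequences of landed lemmas (DLR consistency, the tilt inequality, the thermal excess and floor); (SD-tail), (CM-tail) and
the NT floors stay OPEN; nothing of E0′, NT or a gap is claimed; finite-volume ∕ conditional; the Yang–Mills mass gap is NOT proved; not Clay.
-/

set_option autoImplicit false

noncomputable section

open MeasureTheory Finset Filter
open Literature.MathematicalPhysics.QuantumFieldTheory (LatticeRep haarProbability)
open Literature.MathematicalPhysics.QuantumLattice (LGConfig ZdEdge ZdPlaquette plaquettesTouching plaquetteEdges plaquetteObs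
  mem_plaquettesTouching_iff isCylinder_plaquetteObs fundamentalRep fundamentalLatticeRep wilsonBoundaryAction continuous_wilsonBoundaryAction
  isProbabilityMeasure_ymSpecification ymSpecification continuous_integral_ymSpecification exists_bound_of_continuous)
open Literature.Probability.LatticeModels (glueWith glueWith_apply_mem glueWith_apply_not_mem measurable_glueWith)
open Summit.QuantumFields.YangMills.Cruxes.OSLegsFromFemtoAndGap.DlrCollarTransfer (cubeSites cubeEdges depth kerE plane continuous_plane depth_centred)
open Summit.QuantumFields.YangMills.Cruxes.NT.BoundaryLaw (cubeSites_subset cubeEdges_subset kerE_kerE_of_subset)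
open Summit.QuantumFields.YangMills.Cruxes.UVSeamRec.BoundaryLawPenetration (cubeMinimisers)
open Summit.QuantumFields.YangMills.Cruxes.UVSeamRec.ClassicalResponse.ThermalFloor (kerE_deficit_ge)

namespace Summit.QuantumFields.YangMills.Cruxes.UVSeamRec.ClassicalResponse.ColdWall

/-! ### §1 Domain monotonicity of the classical response (every compact `G`) -/

section General

variable {G : Type} [Group G] [TopologicalSpace G] [IsTopologicalGroup G] [CompactSpace G] [MeasurableSpace G] [BorelSpace G]
  (r : LatticeRep G)

omit [Group G] [TopologicalSpace G] [IsTopologicalGroup G] [CompactSpace G] [MeasurableSpace G] [BorelSpace G] in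
/-- Gluing the restriction of a configuration that already agrees with the exterior off `Λ` gives the configuration back. [folklore] -/
theorem glueWith_restrict_eq_of_eqOff {Λ : Finset (ZdEdge 4)} {V η : LGConfig 4 G} (h : ∀ e, e ∉ Λ → V e = η e) :
    glueWith Λ (fun e : ↥Λ => V e) η = V := by
  funext e
  by_cases he : e ∈ Λ
  · rw [glueWith_apply_mem _ _ _ he]
  · rw [glueWith_apply_not_mem _ _ _ he, h e he]

omit [IsTopologicalGroup G] [CompactSpace G] [MeasurableSpace G] [BorelSpace G] in
/-- **Action splitting.**  For nested edge sets `Λ' ⊆ Λ` and configurations `V`, `U` that agree off `Λ'`, the plaquettes touching `Λ` but not `Λ'`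
see the same links, so `S_Λ(V) − S_Λ'(V) = S_Λ(U) − S_Λ'(U)`. [folklore] -/
theorem wilsonBoundaryAction_sub_eq_of_eqOff {Λ' Λ : Finset (ZdEdge 4)} (h : Λ' ⊆ Λ) {U V : LGConfig 4 G}
    (hVU : ∀ e, e ∉ Λ' → V e = U e) :
    wilsonBoundaryAction r.ρ Λ V - wilsonBoundaryAction r.ρ Λ' V = wilsonBoundaryAction r.ρ Λ U - wilsonBoundaryAction r.ρ Λ' U := by
  have hmono := Literature.MathematicalPhysics.QuantumFieldTheory.plaquettesTouching_mono h
  have split : ∀ X : LGConfig 4 G, wilsonBoundaryAction r.ρ Λ X =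
      (∑ p ∈ plaquettesTouching Λ \ plaquettesTouching Λ', ((r.N : ℝ) - plaquetteObs r.ρ p.1 p.2.1.1 p.2.1.2 X)) +
        wilsonBoundaryAction r.ρ Λ' X := fun X => by
    unfold wilsonBoundaryAction
    rw [Finset.sum_sdiff hmono]
  have hdiff : ∑ p ∈ plaquettesTouching Λ \ plaquettesTouching Λ', ((r.N : ℝ) - plaquetteObs r.ρ p.1 p.2.1.1 p.2.1.2 V) =
      ∑ p ∈ plaquettesTouching Λ \ plaquettesTouching Λ', ((r.N : ℝ) - plaquetteObs r.ρ p.1 p.2.1.1 p.2.1.2 U) := by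
    refine Finset.sum_congr rfl fun p hp => ?_
    rw [Finset.mem_sdiff] at hp
    have hoff : ∀ e ∈ plaquetteEdges p, e ∉ Λ' := fun e he heΛ =>
      hp.2 (mem_plaquettesTouching_iff.2 ⟨e, Finset.mem_inter.2 ⟨he, heΛ⟩⟩)
    rw [isCylinder_plaquetteObs r.ρ p (fun e he => hVU e (hoff e he))]
  rw [split V, split U, hdiff]
  ring

omit [BorelSpace G] in
/-- **DOMAIN MONOTONICITY OF THE CLASSICAL RESPONSE.**  For nested cubes `Λ' = cubeEdges c' b' ⊆ Λ = cubeEdges c b`, a tilt `s > 0`, every exterior `η`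
and EVERY inner configuration `ζ` of the big cube (`U := ζ ∨ η`):
`classicalResponse_{Λ'}(s)(U) ≤ classicalResponse_{Λ}(s)(η) + [S_Λ(U) − m₀^{Λ}(η)]/s`.
Proof: a minimiser `ξ` of the small tilted problem with exterior `U` gives a competitor `V = ξ ∨ U` of the big tilted problem with exterior `η`, whose
big action splits as `S_Λ'(V) + [S_Λ(U) − S_Λ'(U)]`; and `m₀^{Λ'}(U) ≤ S_Λ'(U)`. [folklore] -/
theorem classicalResponse_le_of_subset_add_excess {c c' : Fin 4 → ℤ} {b b' : ℕ} (hsub : cubeEdges c' b' ⊆ cubeEdges c b)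
    (q : Fin 4 × Fin 4) (x : Fin 4 → ℤ) {s : ℝ} (hs : 0 < s) (η : LGConfig 4 G) (ζ : ↥(cubeEdges c b) → G) :
    classicalResponse r c' b' q x s (glueWith (cubeEdges c b) ζ η) ≤
      classicalResponse r c b q x s η +
        (wilsonBoundaryAction r.ρ (cubeEdges c b) (glueWith (cubeEdges c b) ζ η) - tiltedMin r c b q x 0 η) / s := by
  set U : LGConfig 4 G := glueWith (cubeEdges c b) ζ η with hU
  -- a minimiser of the small tilted problem with exterior `U`, glued into `U`
  obtain ⟨ξ, hξ⟩ := exists_tiltedMin_eq (r := r) c' b' q x s U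
  set V : LGConfig 4 G := glueWith (cubeEdges c' b') ξ U with hV
  have hVU : ∀ e, e ∉ cubeEdges c' b' → V e = U e := fun e he => glueWith_apply_not_mem _ _ _ he
  have hVη : ∀ e, e ∉ cubeEdges c b → V e = η e := fun e he => by
    rw [hVU e (fun he' => he (hsub he')), hU, glueWith_apply_not_mem _ _ _ he]
  have hVglue : glueWith (cubeEdges c b) (fun e : ↥(cubeEdges c b) => V e) η = V := glueWith_restrict_eq_of_eqOff hVη
  -- the big tilted minimum is at most the tilted action of the competitor `V`
  have h1 : tiltedMin r c b q x s η ≤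
      wilsonBoundaryAction r.ρ (cubeEdges c b) V - s * ((r.N : ℝ) - plane G r q x V) := by
    have h := tiltedMin_le (r := r) c b q x s η (fun e : ↥(cubeEdges c b) => V e)
    unfold tiltedAction at h
    rwa [hVglue] at h
  -- action splitting between `V` and `U`
  have h2 := wilsonBoundaryAction_sub_eq_of_eqOff r hsub hVU
  -- the small tilted minimum is realised at `V`
  have h3 : tiltedMin r c' b' q x s U = wilsonBoundaryAction r.ρ (cubeEdges c' b') V - s * ((r.N : ℝ) - plane G r q x V) := by
    rw [← hξ]
    rfl
  -- the small untilted minimum is at most the small action of `U` itself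
  have h4 : tiltedMin r c' b' q x 0 U ≤ wilsonBoundaryAction r.ρ (cubeEdges c' b') U := by
    have h := tiltedMin_le (r := r) c' b' q x 0 U (fun e : ↥(cubeEdges c' b') => U e)
    rw [tiltedAction_zero, glueWith_restrict_eq_of_eqOff (fun e _ => rfl)] at h
    exact h
  unfold classicalResponse
  rw [← add_div, div_le_div_iff_of_pos_right hs]
  linarith [h1, h2, h3, h4]

omit [BorelSpace G] in
/-- **At a ground state the small-cube response is dominated by the big-cube response**: for `ζ ∈ cubeMinimisers` of the big cube with exterior `η`,
`classicalResponse_{Λ'}(s)(ζ ∨ η) ≤ classicalResponse_{Λ}(s)(η)` (the excess vanishes). [folklore] -/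
theorem classicalResponse_le_of_subset_of_mem_cubeMinimisers {c c' : Fin 4 → ℤ} {b b' : ℕ} (hsub : cubeEdges c' b' ⊆ cubeEdges c b)
    (q : Fin 4 × Fin 4) (x : Fin 4 → ℤ) {s : ℝ} (hs : 0 < s) {η : LGConfig 4 G} {ζ : ↥(cubeEdges c b) → G}
    (hζ : ζ ∈ cubeMinimisers G r c b η) :
    classicalResponse r c' b' q x s (glueWith (cubeEdges c b) ζ η) ≤ classicalResponse r c b q x s η := by
  have h := classicalResponse_le_of_subset_add_excess r hsub q x hs η ζ
  rw [tiltedMin_zero_eq_of_mem_cubeMinimisers q x hζ, sub_self, zero_div, add_zero] at h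
  exact h

/-! ### §2 The LOCALISED tilt inequality in kernel form (every compact `G`) -/

/-- Continuity of the cube-kernel mean of a continuous observable in the exterior (tree `continuous_integral_ymSpecification`). [folklore] -/
theorem continuous_kerE_of_continuous (β : ℝ) (c : Fin 4 → ℤ) (b : ℕ) {F : LGConfig 4 G → ℝ} (hF : Continuous F) :
    Continuous fun η : LGConfig 4 G => kerE G r β c b η F := by
  haveI := r.secondCountableTopology
  obtain ⟨M, hM⟩ := exists_bound_of_continuous hF
  unfold kerE
  exact continuous_integral_ymSpecification r.ρ r.continuous β (cubeEdges c b) hF hM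

/-- The cube kernel of an observable plus a constant. [folklore] -/
theorem kerE_add_const (β : ℝ) (c : Fin 4 → ℤ) (b : ℕ) (η : LGConfig 4 G) {F : LGConfig 4 G → ℝ} (hF : Continuous F) (p : ℝ) :
    kerE G r β c b η (fun U => F U + p) = kerE G r β c b η F + p := by
  haveI := r.secondCountableTopology
  haveI := isProbabilityMeasure_ymSpecification r.ρ r.continuous β (cubeEdges c b) η
  unfold kerE
  rw [integral_add (Summit.QuantumFields.YangMills.Theorems.OSLegsFromFemtoAndGap.StubLower.integrable_of_continuous_compact hF)
    (integrable_const p), integral_const, smul_eq_mul, probReal_univ, one_mul]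

/-- **DLR for the centre deficit**: for nested cubes `Λ' ⊆ Λ`, `kerE^η_Λ(N − plane q x) = kerE^η_Λ(U ↦ kerE^U_{Λ'}(N − plane q x))`
(tree `kerE_kerE_of_subset`). [folklore] -/
theorem kerE_deficit_eq_kerE_kerE_of_subset (β : ℝ) {c c' : Fin 4 → ℤ} {b b' : ℕ} (hsub : cubeEdges c' b' ⊆ cubeEdges c b)
    (q : Fin 4 × Fin 4) (x : Fin 4 → ℤ) (η : LGConfig 4 G) :
    kerE G r β c b η (fun U => (r.N : ℝ) - plane G r q x U) =
      kerE G r β c b η (fun U => kerE G r β c' b' U (fun V => (r.N : ℝ) - plane G r q x V)) := by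
  haveI := r.secondCountableTopology
  have hF : Measurable fun V : LGConfig 4 G => (r.N : ℝ) - plane G r q x V :=
    (continuous_const.sub (continuous_plane r q x)).measurable
  have hM : ∀ U : LGConfig 4 G, |(r.N : ℝ) - plane G r q x U| ≤ 2 * r.N := fun U => by
    rw [abs_of_nonneg (deficit_nonneg (r := r) q x U)]
    exact deficit_le_two_mul (r := r) q x U
  exact (kerE_kerE_of_subset G r β hsub η hF hM).symm

/-- **THE LOCALISED TILT INEQUALITY (kernel form, every compact `G`).**  For nested cubes `Λ' = cubeEdges c' b' ⊆ Λ = cubeEdges c b` and every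
exterior `η`:
`kerE^η_Λ(N − plane q x) ≤ kerE^η_Λ( U ↦ classicalResponse₁^{Λ'}(U) + [kerE^U_{Λ'}(S_Λ') − m₀^{Λ'}(U)] )`
— DLR consistency and the tilt inequality inside the SMALL cube: the quantum centre deficit is paid by the MEAN small-cube classical response plus the
MEAN small-cube thermal excess, both under the big-cube state. [folklore] -/
theorem kerE_deficit_le_kerE_classicalResponse_add_excess_of_subset (β : ℝ) {c c' : Fin 4 → ℤ} {b b' : ℕ}
    (hsub : cubeEdges c' b' ⊆ cubeEdges c b) (q : Fin 4 × Fin 4) (x : Fin 4 → ℤ) (η : LGConfig 4 G) :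
    kerE G r β c b η (fun U => (r.N : ℝ) - plane G r q x U) ≤
      kerE G r β c b η (fun U => classicalResponse r c' b' q x 1 U +
        (kerE G r β c' b' U (wilsonBoundaryAction r.ρ (cubeEdges c' b')) - tiltedMin r c' b' q x 0 U)) := by
  rw [kerE_deficit_eq_kerE_kerE_of_subset r β hsub q x η]
  have hc1 : Continuous fun U : LGConfig 4 G => kerE G r β c' b' U (fun V => (r.N : ℝ) - plane G r q x V) :=
    continuous_kerE_of_continuous r β c' b' (continuous_const.sub (continuous_plane r q x))
  have hc2 : Continuous fun U : LGConfig 4 G => classicalResponse r c' b' q x 1 U +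
      (kerE G r β c' b' U (wilsonBoundaryAction r.ρ (cubeEdges c' b')) - tiltedMin r c' b' q x 0 U) :=
    (continuous_classicalResponse _ _ q x 1).add
      ((continuous_kerE_of_continuous r β c' b' (continuous_wilsonBoundaryAction r.ρ r.continuous _)).sub (continuous_tiltedMin _ _ q x 0))
  exact kerE_mono_of_forall_glueWith r β c b η hc1 hc2 fun ζ => kerE_deficit_le_classicalResponse_add_excess r β c' b' q x _

end General

/-! ### §3 `SU(2)`: the centre deficit and the response to the exterior are paid by the MEAN LOCAL classical response plus an `R`-independent slop -/

section SU2

/-- The cube of radius `r₀ + 1` around `x` sits inside the cube of radius `R + 1` around `x` for `r₀ ≤ R` (interior links). [folklore] -/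
theorem cubeEdges_centred_subset_of_le (x : Fin 4 → ℤ) {r₀ R : ℕ} (h : r₀ ≤ R) :
    cubeEdges (fun k => x k - (r₀ + 1)) (2 * r₀ + 3) ⊆ cubeEdges (fun k => x k - (R + 1)) (2 * R + 3) :=
  cubeEdges_subset (cubeSites_subset fun j => ⟨by omega, by push_cast; omega⟩)

/-- **LOCALISED CENTRE-DEFICIT BOUND** (`SU(2)`, `β ≥ 1`, `r₀ ≤ R`, every plane `q`, site `x`, EVERY exterior `η`):
`kerE^η_{(x−R−1,2R+3)}(2 − plane q x) ≤ kerE^η_{(x−R−1,2R+3)}(classicalResponse₁^{(x−r₀−1,2r₀+3)}) + 120(2r₀+3)⁴(38 + 12 log β)/β`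
— the thermal slop is that of the SMALL cube of radius `r₀ + 1` (LEAD g16's `kerE_deficit_le_classicalResponse_add` inside, DLR outside). [folklore] -/
theorem kerE_deficit_le_kerE_localResponse_add {β : ℝ} (hβ : 1 ≤ β) {r₀ R : ℕ} (hr : r₀ ≤ R) (q : Fin 4 × Fin 4) (x : Fin 4 → ℤ)
    (η : LGConfig 4 (Matrix.specialUnitaryGroup (Fin 2) ℂ)) :
    kerE (Matrix.specialUnitaryGroup (Fin 2) ℂ) (fundamentalLatticeRep 2) β (fun k => x k - (R + 1)) (2 * R + 3) η
        (fun U => 2 - plane (Matrix.specialUnitaryGroup (Fin 2) ℂ) (fundamentalLatticeRep 2) q x U) ≤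
      kerE (Matrix.specialUnitaryGroup (Fin 2) ℂ) (fundamentalLatticeRep 2) β (fun k => x k - (R + 1)) (2 * R + 3) η
          (classicalResponse (fundamentalLatticeRep 2) (fun k => x k - (r₀ + 1)) (2 * r₀ + 3) q x 1) +
        120 * ((2 * r₀ + 3 : ℕ) : ℝ) ^ 4 * ((38 + 12 * Real.log β) / β) := by
  set rF : LatticeRep (Matrix.specialUnitaryGroup (Fin 2) ℂ) := fundamentalLatticeRep 2 with hrF
  have hN : ((fundamentalLatticeRep 2).N : ℝ) = 2 := by simp
  have hsub := cubeEdges_centred_subset_of_le x hr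
  -- DLR: the centre deficit is the big-cube mean of the small-cube centre deficit
  have hdlr := kerE_deficit_eq_kerE_kerE_of_subset rF β hsub q x η
  simp only [hrF, hN] at hdlr
  rw [hdlr]
  -- pointwise inner bound (g16) and monotonicity of the big kernel
  have hc1 : Continuous fun U : LGConfig 4 (Matrix.specialUnitaryGroup (Fin 2) ℂ) =>
      kerE (Matrix.specialUnitaryGroup (Fin 2) ℂ) (fundamentalLatticeRep 2) β (fun k => x k - (r₀ + 1)) (2 * r₀ + 3) U
        (fun V => 2 - plane (Matrix.specialUnitaryGroup (Fin 2) ℂ) (fundamentalLatticeRep 2) q x V) :=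
    continuous_kerE_of_continuous (fundamentalLatticeRep 2) β _ _ (continuous_const.sub (continuous_plane (fundamentalLatticeRep 2) q x))
  have hcr : Continuous (classicalResponse (fundamentalLatticeRep 2) (fun k => x k - ((r₀ : ℤ) + 1)) (2 * r₀ + 3) q x 1) :=
    continuous_classicalResponse _ _ q x 1
  have hc2 : Continuous fun U : LGConfig 4 (Matrix.specialUnitaryGroup (Fin 2) ℂ) =>
      classicalResponse (fundamentalLatticeRep 2) (fun k => x k - ((r₀ : ℤ) + 1)) (2 * r₀ + 3) q x 1 U +
        120 * ((2 * r₀ + 3 : ℕ) : ℝ) ^ 4 * ((38 + 12 * Real.log β) / β) := hcr.add continuous_const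
  have hmono := kerE_mono_of_forall_glueWith (fundamentalLatticeRep 2) β (fun k => x k - ((R : ℤ) + 1)) (2 * R + 3) η hc1 hc2
    (fun ζ => kerE_deficit_le_classicalResponse_add hβ r₀ q x _)
  rw [kerE_add_const (fundamentalLatticeRep 2) β _ _ η hcr] at hmono
  exact hmono

/-- **THE RESPONSE TO THE EXTERIOR IS AT MOST THE LARGER MEAN LOCAL CLASSICAL RESPONSE PLUS THE LOCAL SLOP** (`SU(2)`, `β ≥ 1`, `r₀ ≤ R`,
`q.1 < q.2`, EVERY exterior `η`):
`|kerE^η_R(plane q x) − kerE^𝟙_R(plane q x)| ≤ max(kerE^η_R cr₁^{(r₀)}, kerE^𝟙_R cr₁^{(r₀)}) + 120(2r₀+3)⁴(38 + 12 log β)/β`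
(both centre deficits are non-negative, each is bounded by §3's localised bound). [folklore] -/
theorem abs_kerE_plane_sub_le_localResponse_add {β : ℝ} (hβ : 1 ≤ β) {r₀ R : ℕ} (hr : r₀ ≤ R) (q : Fin 4 × Fin 4)
    (x : Fin 4 → ℤ) (η : LGConfig 4 (Matrix.specialUnitaryGroup (Fin 2) ℂ)) :
    |kerE (Matrix.specialUnitaryGroup (Fin 2) ℂ) (fundamentalLatticeRep 2) β (fun k => x k - (R + 1)) (2 * R + 3) η
          (plane (Matrix.specialUnitaryGroup (Fin 2) ℂ) (fundamentalLatticeRep 2) q x) -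
        kerE (Matrix.specialUnitaryGroup (Fin 2) ℂ) (fundamentalLatticeRep 2) β (fun k => x k - (R + 1)) (2 * R + 3) 1
          (plane (Matrix.specialUnitaryGroup (Fin 2) ℂ) (fundamentalLatticeRep 2) q x)| ≤
      max (kerE (Matrix.specialUnitaryGroup (Fin 2) ℂ) (fundamentalLatticeRep 2) β (fun k => x k - (R + 1)) (2 * R + 3) η
            (classicalResponse (fundamentalLatticeRep 2) (fun k => x k - (r₀ + 1)) (2 * r₀ + 3) q x 1))
          (kerE (Matrix.specialUnitaryGroup (Fin 2) ℂ) (fundamentalLatticeRep 2) β (fun k => x k - (R + 1)) (2 * R + 3) 1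
            (classicalResponse (fundamentalLatticeRep 2) (fun k => x k - (r₀ + 1)) (2 * r₀ + 3) q x 1)) +
        120 * ((2 * r₀ + 3 : ℕ) : ℝ) ^ 4 * ((38 + 12 * Real.log β) / β) := by
  have hN : ((fundamentalLatticeRep 2).N : ℝ) = 2 := by simp
  have hη := kerE_deficit_le_kerE_localResponse_add hβ hr q x η
  have h1 := kerE_deficit_le_kerE_localResponse_add hβ hr q x (1 : LGConfig 4 (Matrix.specialUnitaryGroup (Fin 2) ℂ))
  have hη0 := (kerE_deficit_mem_Icc (r := fundamentalLatticeRep 2) β (fun k => x k - ((R : ℤ) + 1)) (2 * R + 3) η q x).1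
  have h10 := (kerE_deficit_mem_Icc (r := fundamentalLatticeRep 2) β (fun k => x k - ((R : ℤ) + 1)) (2 * R + 3)
    (1 : LGConfig 4 (Matrix.specialUnitaryGroup (Fin 2) ℂ)) q x).1
  simp only [hN] at hη0 h10
  rw [kerE_const_sub (r := fundamentalLatticeRep 2) β _ _ η (continuous_plane (fundamentalLatticeRep 2) q x) 2] at hη hη0
  rw [kerE_const_sub (r := fundamentalLatticeRep 2) β _ _ (1 : LGConfig 4 (Matrix.specialUnitaryGroup (Fin 2) ℂ))
    (continuous_plane (fundamentalLatticeRep 2) q x) 2] at h1 h10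
  have hmaxη := le_max_left
    (kerE (Matrix.specialUnitaryGroup (Fin 2) ℂ) (fundamentalLatticeRep 2) β (fun k => x k - (R + 1)) (2 * R + 3) η
      (classicalResponse (fundamentalLatticeRep 2) (fun k => x k - (r₀ + 1)) (2 * r₀ + 3) q x 1))
    (kerE (Matrix.specialUnitaryGroup (Fin 2) ℂ) (fundamentalLatticeRep 2) β (fun k => x k - (R + 1)) (2 * R + 3) 1
      (classicalResponse (fundamentalLatticeRep 2) (fun k => x k - (r₀ + 1)) (2 * r₀ + 3) q x 1))
  have hmax1 := le_max_right
    (kerE (Matrix.specialUnitaryGroup (Fin 2) ℂ) (fundamentalLatticeRep 2) β (fun k => x k - (R + 1)) (2 * R + 3) η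
      (classicalResponse (fundamentalLatticeRep 2) (fun k => x k - (r₀ + 1)) (2 * r₀ + 3) q x 1))
    (kerE (Matrix.specialUnitaryGroup (Fin 2) ℂ) (fundamentalLatticeRep 2) β (fun k => x k - (R + 1)) (2 * R + 3) 1
      (classicalResponse (fundamentalLatticeRep 2) (fun k => x k - (r₀ + 1)) (2 * r₀ + 3) q x 1))
  rw [abs_le]
  constructor <;> linarith

/-- **(CW♭) AT `(β, R, q, x, η)` FROM A LOCAL RESPONSE BUDGET.**  If `0 < C_s`, `0 < C₁`, `r₀ ≤ R`, `β ≥ 1` and the local budget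
`(R⁴/C₁)·(max(kerE^η_R cr₁^{(r₀)}, kerE^𝟙_R cr₁^{(r₀)}) + 120(2r₀+3)⁴(38 + 12 log β)/β) ≤ A₂ + carrierCl C_s 1 1 R q x η` holds, then so does the flat
cold-wall split inequality at `(β, R, q, x, η)`: the stub's sentence at a point REDUCES to a bound on two MEAN LOCAL classical responses. [folklore] -/
theorem coldWallSplitFlat_inequality_of_localBudget {β : ℝ} (hβ : 1 ≤ β) {C_s C₁ A₂ : ℝ} (hC₁ : 0 < C₁) {r₀ R : ℕ} (hr : r₀ ≤ R)
    (q : Fin 4 × Fin 4) (x : Fin 4 → ℤ) (η : LGConfig 4 (Matrix.specialUnitaryGroup (Fin 2) ℂ))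
    (hbudget : (R : ℝ) ^ 4 / C₁ *
        (max (kerE (Matrix.specialUnitaryGroup (Fin 2) ℂ) (fundamentalLatticeRep 2) β (fun k => x k - (R + 1)) (2 * R + 3) η
              (classicalResponse (fundamentalLatticeRep 2) (fun k => x k - (r₀ + 1)) (2 * r₀ + 3) q x 1))
            (kerE (Matrix.specialUnitaryGroup (Fin 2) ℂ) (fundamentalLatticeRep 2) β (fun k => x k - (R + 1)) (2 * R + 3) 1
              (classicalResponse (fundamentalLatticeRep 2) (fun k => x k - (r₀ + 1)) (2 * r₀ + 3) q x 1)) +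
          120 * ((2 * r₀ + 3 : ℕ) : ℝ) ^ 4 * ((38 + 12 * Real.log β) / β)) ≤
        A₂ + carrierCl (fundamentalLatticeRep 2) C_s 1 1 R q x η) :
    (R : ℝ) ^ 4 / C₁ * |kerE (Matrix.specialUnitaryGroup (Fin 2) ℂ) (fundamentalLatticeRep 2) β (fun k => x k - (R + 1)) (2 * R + 3) η
          (plane (Matrix.specialUnitaryGroup (Fin 2) ℂ) (fundamentalLatticeRep 2) q x) -
        kerE (Matrix.specialUnitaryGroup (Fin 2) ℂ) (fundamentalLatticeRep 2) β (fun k => x k - (R + 1)) (2 * R + 3) 1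
          (plane (Matrix.specialUnitaryGroup (Fin 2) ℂ) (fundamentalLatticeRep 2) q x)| ≤
      A₂ + carrierCl (fundamentalLatticeRep 2) C_s 1 1 R q x η := by
  have h := abs_kerE_plane_sub_le_localResponse_add hβ hr q x η
  have hR : 0 ≤ (R : ℝ) ^ 4 / C₁ := by positivity
  exact (mul_le_mul_of_nonneg_left h hR).trans hbudget

/-! ### §4 `SU(2)`: the ceiling of separate-deficit methods — two thermal floors -/

/-- **Two thermal floors** (`SU(2)`, `β ≥ 0`, every cube `(x − R − 1, 2R+3)`, plane `q.1 < q.2`, EVERY exterior `η`): each of the two centre deficits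
compared by (CW♭) is at least `6/(24β+3)` (`ThermalFloor.kerE_deficit_ge`), so their sum is at least `12/(24β+3)` and their maximum at least `6/(24β+3)`.
[folklore] -/
theorem kerE_deficit_add_kerE_one_deficit_ge {β : ℝ} (hβ : 0 ≤ β) (R : ℕ) (q : Fin 4 × Fin 4) (hq : q.1 < q.2) (x : Fin 4 → ℤ)
    (η : LGConfig 4 (Matrix.specialUnitaryGroup (Fin 2) ℂ)) :
    12 / (24 * β + 3) ≤
      kerE (Matrix.specialUnitaryGroup (Fin 2) ℂ) (fundamentalLatticeRep 2) β (fun k => x k - (R + 1)) (2 * R + 3) η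
          (fun U => 2 - plane (Matrix.specialUnitaryGroup (Fin 2) ℂ) (fundamentalLatticeRep 2) q x U) +
        kerE (Matrix.specialUnitaryGroup (Fin 2) ℂ) (fundamentalLatticeRep 2) β (fun k => x k - (R + 1)) (2 * R + 3) 1
          (fun U => 2 - plane (Matrix.specialUnitaryGroup (Fin 2) ℂ) (fundamentalLatticeRep 2) q x U) := by
  have h1 := kerE_deficit_ge hβ R q hq x η
  have h2 := kerE_deficit_ge hβ R q hq x (1 : LGConfig 4 (Matrix.specialUnitaryGroup (Fin 2) ℂ))
  have e : 12 / (24 * β + 3) = 6 / (24 * β + 3) + 6 / (24 * β + 3) := by ring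
  rw [e]
  exact add_le_add h1 h2

/-- **THE CEILING OF THE METHOD CLASS.**  At the identity exterior the right-hand side of (CW♭) is the bare tolerance `A₂` (`carrierCl_one`), while the
identity exterior's own centre deficit in tolerance units is at least `6R⁴/(C₁(24β+3))`; hence as soon as `C₁A₂(24β+3) < 6R⁴` (i.e. `R⁴ > 4C₁A₂β + C₁A₂/2`),
`A₂ + carrierCl C_s 1 1 R q x 𝟙 < (R⁴/C₁)·kerE^𝟙(2 − plane q x)`.  Every bound of `|kerE^η(plane) − kerE^𝟙(plane)|` by a quantity dominating one of
the two (non-negative) centre deficits — the tilt-inequality bounds of g15∕g16∕g18 and §§2–3 — therefore fails to give (CW♭) beyond `R⁴ ≍ 4C₁A₂β`: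
the femto tail needs the CANCELLATION of the two thermal deficits. [folklore] -/
theorem tolerance_lt_kerE_one_deficit_of_lt {β : ℝ} (hβ : 0 ≤ β) {C_s C₁ A₂ : ℝ} (hC₁ : 0 < C₁) {R : ℕ} (q : Fin 4 × Fin 4) (hq : q.1 < q.2)
    (x : Fin 4 → ℤ) (hR : C₁ * A₂ * (24 * β + 3) < 6 * (R : ℝ) ^ 4) :
    A₂ + carrierCl (fundamentalLatticeRep 2) C_s 1 1 R q x (1 : LGConfig 4 (Matrix.specialUnitaryGroup (Fin 2) ℂ)) <
      (R : ℝ) ^ 4 / C₁ *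
        kerE (Matrix.specialUnitaryGroup (Fin 2) ℂ) (fundamentalLatticeRep 2) β (fun k => x k - (R + 1)) (2 * R + 3) 1
          (fun U => 2 - plane (Matrix.specialUnitaryGroup (Fin 2) ℂ) (fundamentalLatticeRep 2) q x U) := by
  rw [carrierCl_one (fundamentalLatticeRep 2) C_s 1 R q hq x, add_zero]
  have hfloor := kerE_deficit_ge hβ R q hq x (1 : LGConfig 4 (Matrix.specialUnitaryGroup (Fin 2) ℂ))
  have hb : 0 < 24 * β + 3 := by linarith
  have hRC : 0 ≤ (R : ℝ) ^ 4 / C₁ := by positivity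
  have h1 : (R : ℝ) ^ 4 / C₁ * (6 / (24 * β + 3)) ≤ (R : ℝ) ^ 4 / C₁ *
      kerE (Matrix.specialUnitaryGroup (Fin 2) ℂ) (fundamentalLatticeRep 2) β (fun k => x k - (R + 1)) (2 * R + 3) 1
        (fun U => 2 - plane (Matrix.specialUnitaryGroup (Fin 2) ℂ) (fundamentalLatticeRep 2) q x U) :=
    mul_le_mul_of_nonneg_left hfloor hRC
  refine lt_of_lt_of_le ?_ h1
  rw [div_mul_div_comm, lt_div_iff₀ (mul_pos hC₁ hb)]
  linarith

/-- **Corollary (every exterior): the larger of the two centre deficits, in tolerance units, is at least `6R⁴/(C₁(24β+3))`** — the quantity §3 bounds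
`(R⁴/C₁)|kerE^η(plane) − kerE^𝟙(plane)|` by can never be below this floor, whatever the exterior. [folklore] -/
theorem floor_le_tolerance_units_max_deficit {β : ℝ} (hβ : 0 ≤ β) {C₁ : ℝ} (hC₁ : 0 < C₁) (R : ℕ) (q : Fin 4 × Fin 4) (hq : q.1 < q.2)
    (x : Fin 4 → ℤ) (η : LGConfig 4 (Matrix.specialUnitaryGroup (Fin 2) ℂ)) :
    (R : ℝ) ^ 4 / C₁ * (6 / (24 * β + 3)) ≤
      (R : ℝ) ^ 4 / C₁ * max
        (kerE (Matrix.specialUnitaryGroup (Fin 2) ℂ) (fundamentalLatticeRep 2) β (fun k => x k - (R + 1)) (2 * R + 3) η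
          (fun U => 2 - plane (Matrix.specialUnitaryGroup (Fin 2) ℂ) (fundamentalLatticeRep 2) q x U))
        (kerE (Matrix.specialUnitaryGroup (Fin 2) ℂ) (fundamentalLatticeRep 2) β (fun k => x k - (R + 1)) (2 * R + 3) 1
          (fun U => 2 - plane (Matrix.specialUnitaryGroup (Fin 2) ℂ) (fundamentalLatticeRep 2) q x U)) := by
  have hfloor := kerE_deficit_ge hβ R q hq x η
  have hRC : 0 ≤ (R : ℝ) ^ 4 / C₁ := by positivity
  exact mul_le_mul_of_nonneg_left (hfloor.trans (le_max_left _ _)) hRC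

end SU2

end Summit.QuantumFields.YangMills.Cruxes.UVSeamRec.ClassicalResponse.ColdWall

end
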